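import Literature.AnabelianGeometry.EtaleTheta.Discharge.Sec2SplittingProofs

/-!
# [EtTh] Proposition 2.2 (ii), (iii) DISCHARGED over `CoverDataAx` (proof-only companion)

Mochizuki, *The Étale Theta Function …* [EtTh], Publ. RIMS 45 (2009), §2, Prop 2.2 (ii), (iii),
PRIMS text pp.37–38 (locators `p.N` = PDF pages; bib key `MochizukiEtTh2009`).

PROOF-ONLY companion (no `def`, no new named fact) of `ThetaCovers.lean` (v2) /
`ThetaCoversAxioms.lean` (seat abc-iut-L2-t2), unit W2-L2-06 (abc-iut-L2-t10):

* `minus_mem_eigen` — an element of `Δ_X̲` on which `ι̲` acts by `−1` modulo `Ker` lies in `E`;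
* `inversion_conj_mem_sup` — an inversion `ι̲` with `ι̲² ∈ Ker` normalises `Π_X̲̲ = S · E`
  ("`ι̲` normalizes `D̄_x ≅ Π̄_X̲/Δ̄_X̲̲`", proof of (iii), p.38);
* `sup_zpowers_inf_eq`, `relIndex_sup_zpowers` — (iii), second sentence: `⟨Π_X̲̲, ι̲⟩ ∩ Π_X̲ = Π_X̲̲`
  and `[⟨Π_X̲̲, ι̲⟩ : Π_X̲̲] = 2` (the double covering `X̲̲ → C̲̲` in the cartesian diagram);
* `prop22_ii_holds : X.toCoverData.Prop22_ii`, `prop22_iii_holds : X.toCoverData.Prop22_iii` —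
  the named facts of `ThetaCovers.lean` v2 DISCHARGED (with `prop22_i_holds` of
  `Sec2InversionProofs`, all of Proposition 2.2 is kernel-checked over the interface `CoverDataAx`).
-/

namespace Literature.AnabelianGeometry.EtaleTheta

namespace ThetaCovers

namespace CoverDataAx

universe u

variable {l : ℕ} (X : CoverDataAx.{u} l)

/-- An element `c ∈ Δ_X̲` on which the inversion acts by `−1` modulo `Ker` lies in the
`(−1)`-eigenspace `E` (write `c = e·t`; `ι̲` fixes `t` and inverts `e` and `c` modulo `Ker`, so
`t² ∈ Ker`, `l` odd). [cite: MochizukiEtTh2009, Prop 2.2(i) p.37] -/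
theorem minus_mem_eigen {H H' E : Subgroup X.PiC} {ι : X.PiC}
    (hH' : X.toCoverData.IsTypeLTorsPm H') (hH : H = H' ⊓ X.PiX)
    (hE : X.toCoverData.IsMinusEigen H H' ι E) {c : X.PiC} (hc : c ∈ H ⊓ X.DeltaC)
    (hcm : ι * c * ι⁻¹ * c ∈ X.barKer) : c ∈ E := by
  haveI := X.barTheta_normal
  haveI := X.barKer_normal
  have hT : X.toCoverData.IsTypeLTors H := by rw [hH]; exact hH'.inf_isTypeLTors
  have hHX : H ≤ X.PiX := hT.le
  let π : X.PiC →* X.PiC ⧸ X.barKer := QuotientGroup.mk' X.barKer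
  have hπ : ∀ x, π x = 1 ↔ x ∈ X.barKer := fun x => QuotientGroup.eq_one_iff x
  have hπ4 : ∀ a b c d : X.PiC, a * b * c⁻¹ * d ∈ X.barKer ↔ π a * π b * (π c)⁻¹ * π d = 1 := by
    intro a b c d
    rw [← hπ, map_mul, map_mul, map_mul, map_inv]
  have hc' : c ∈ E ⊔ X.barTheta := by rw [hE.sup_eq]; exact hc
  obtain ⟨e, he, t, ht, rfl⟩ := Subgroup.mem_sup_of_normal_right.mp hc'
  have heΔ : e ∈ X.DeltaX := ⟨hHX (hE.le he).1, (hE.le he).2⟩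
  have hem : π ι * π e * (π ι)⁻¹ = (π e)⁻¹ := by
    rw [← mul_eq_one_iff_eq_inv, ← hπ4]; exact hE.minus e he
  have htp : π ι * π t * (π ι)⁻¹ = π t := by
    have h := (hπ4 ι t ι t⁻¹).mp (hE.plus t ht)
    rwa [map_inv, mul_inv_eq_one] at h
  have hcm' : π ι * (π e * π t) * (π ι)⁻¹ = (π e * π t)⁻¹ := by
    rw [← mul_eq_one_iff_eq_inv, ← map_mul, ← hπ4]; exact hcm
  have hET : Commute (π e) (π t) := by
    have h1 : π t * π e * (π t)⁻¹ * π e⁻¹ = 1 :=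
      (hπ4 t e t e⁻¹).mp (X.barTheta_central t ht e heΔ)
    rw [map_inv] at h1
    change π e * π t = π t * π e
    calc π e * π t = (π t * π e * (π t)⁻¹ * (π e)⁻¹)⁻¹ * (π t * π e) := by group
      _ = π t * π e := by rw [h1, inv_one, one_mul]
  have h2 : π t * π t = 1 := by
    have h1 : (π e)⁻¹ * π t = (π e)⁻¹ * (π t)⁻¹ := by
      calc (π e)⁻¹ * π t = (π ι * π e * (π ι)⁻¹) * (π ι * π t * (π ι)⁻¹) := by rw [hem, htp]
        _ = π ι * (π e * π t) * (π ι)⁻¹ := by group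
        _ = (π e * π t)⁻¹ := hcm'
        _ = (π t * π e)⁻¹ := by rw [hET.eq]
        _ = (π e)⁻¹ * (π t)⁻¹ := mul_inv_rev _ _
    have h3 : π t = (π t)⁻¹ := mul_left_cancel h1
    nth_rw 1 [h3]
    exact inv_mul_cancel _
  have htK : t ∈ X.barKer := by
    refine X.mem_barKer_of_sq_mem (X.barTheta_le ht) ?_
    rw [← hπ, map_mul]; exact h2
  exact E.mul_mem he (hE.barKer_le htK)

/-- An inversion `ι̲` with `ι̲² ∈ Ker(Δ_X ↠ Δ̄_X)` normalises `Π_X̲̲ = S · E` (proof of Prop 2.2 (iii),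
p.38: "`ι̲` normalizes `D_x ≅ Π_X̲/Δ_X̲̲` … conjugation by `ι̲` induces the identity on `Δ̄_Θ` and
`G_K`"): the commutator `[ι̲, s]` of `ι̲` with `s ∈ S` lies in `Δ_X̲` and is inverted by `ι̲`
modulo `Ker` (as `ι̲² ∈ Ker`), hence lies in `E`. [cite: MochizukiEtTh2009, Prop 2.2(iii) p.37] -/
theorem inversion_conj_mem_sup {H H' E S : Subgroup X.PiC} {ι : X.PiC}
    (hH' : X.toCoverData.IsTypeLTorsPm H') (hH : H = H' ⊓ X.PiX)
    (hι : X.toCoverData.IsInversion H' ι) (hE : X.toCoverData.IsMinusEigen H H' ι E)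
    (hS : X.toCoverData.IsSplitting S) (h2 : ι * ι ∈ X.barKer) {p : X.PiC} (hp : p ∈ S ⊔ E) :
    ι * p * ι⁻¹ ∈ S ⊔ E := by
  haveI := X.PiX_normal
  haveI := X.barKer_normal
  have hT : X.toCoverData.IsTypeLTors H := by rw [hH]; exact hH'.inf_isTypeLTors
  have hHX : H ≤ X.PiX := hT.le
  have hSle : S ≤ H :=
    hS.le.trans (sup_le hT.Dx_le (X.barKer_le_barTheta.trans hT.barTheta_le))
  have hEle : E ≤ H := hE.le.trans inf_le_left
  have hιC : X.aug ι = 1 := hι.mem_delta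
  have hHH' : H ≤ H' := by rw [hH]; exact inf_le_left
  have hH'X : ∀ x, x ∈ H' → x ∈ X.PiX → x ∈ H := by intro x h1 h2; rw [hH]; exact ⟨h1, h2⟩
  -- decompose `p = y · z`, `y ∈ S`, `z ∈ E` (inside `Π_X̲`, where `E` is normal)
  haveI : (E.subgroupOf H).Normal :=
    (Subgroup.normal_subgroupOf_iff hEle).mpr fun e g he hg => hE.conj_mem g hg e he
  have hp' : (⟨p, sup_le hSle hEle hp⟩ : H) ∈ S.subgroupOf H ⊔ E.subgroupOf H := by
    rw [← Subgroup.subgroupOf_sup hSle hEle, Subgroup.mem_subgroupOf]; exact hp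
  obtain ⟨y, hy, z, hz, hyz⟩ := Subgroup.mem_sup_of_normal_right.mp hp'
  rw [Subgroup.mem_subgroupOf] at hy hz
  have hxyz : (y : X.PiC) * z = p := congrArg Subtype.val hyz
  -- the commutator `c = ι y ι⁻¹ y⁻¹` lies in `E`
  have hyH' : (y : X.PiC) ∈ H' := hHH' (hSle hy)
  have hc : ι * y * ι⁻¹ * (y : X.PiC)⁻¹ ∈ H ⊓ X.DeltaC := by
    refine ⟨?_, ?_⟩
    · exact hH'X _ (H'.mul_mem (H'.mul_mem (H'.mul_mem hι.mem hyH') (H'.inv_mem hι.mem))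
          (H'.inv_mem hyH'))
        (X.PiX.mul_mem (X.PiX_normal.conj_mem _ (hHX (hSle hy)) ι) (X.PiX.inv_mem (hHX (hSle hy))))
    · change X.aug (ι * y * ι⁻¹ * (y : X.PiC)⁻¹) = 1
      rw [map_mul, map_mul, map_mul, map_inv, map_inv, hιC]
      simp
  have hcm : ι * (ι * y * ι⁻¹ * (y : X.PiC)⁻¹) * ι⁻¹ * (ι * y * ι⁻¹ * (y : X.PiC)⁻¹) ∈ X.barKer := by
    have : ι * (ι * y * ι⁻¹ * (y : X.PiC)⁻¹) * ι⁻¹ * (ι * y * ι⁻¹ * (y : X.PiC)⁻¹) =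
        (ι * ι) * (y * (ι * ι)⁻¹ * (y : X.PiC)⁻¹) := by group
    rw [this]
    exact X.barKer.mul_mem h2 (X.barKer_normal.conj_mem _ (X.barKer.inv_mem h2) y)
  have hcE : ι * y * ι⁻¹ * (y : X.PiC)⁻¹ ∈ E := X.minus_mem_eigen hH' hH hE hc hcm
  -- `ι p ι⁻¹ = (c · y) · (ι z ι⁻¹)`
  have : ι * p * ι⁻¹ = (ι * y * ι⁻¹ * (y : X.PiC)⁻¹) * y * (ι * z * ι⁻¹) := by
    rw [← hxyz]; group
  rw [this]
  exact Subgroup.mul_mem _ (Subgroup.mul_mem _ (Subgroup.mem_sup_right hcE)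
    (Subgroup.mem_sup_left hy)) (Subgroup.mem_sup_right (hE.iota_conj z hz))

/-- Elements of `⟨Π_X̲̲, ι̲⟩ = Π_X̲̲ · ⟨ι̲⟩` are `p` or `p·ι̲` with `p ∈ Π_X̲̲` (`ι̲` normalises `Π_X̲̲`,
`ι̲² ∈ Ker ⊆ Π_X̲̲`). [cite: MochizukiEtTh2009, Prop 2.2(iii) p.37] -/
theorem mem_sup_zpowers_iff {H H' E S : Subgroup X.PiC} {ι : X.PiC}
    (hH' : X.toCoverData.IsTypeLTorsPm H') (hH : H = H' ⊓ X.PiX)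
    (hι : X.toCoverData.IsInversion H' ι) (hE : X.toCoverData.IsMinusEigen H H' ι E)
    (hS : X.toCoverData.IsSplitting S) (h2 : ι * ι ∈ X.barKer) {x : X.PiC} :
    x ∈ (S ⊔ E) ⊔ Subgroup.zpowers ι ↔ x ∈ S ⊔ E ∨ ∃ p ∈ S ⊔ E, x = p * ι := by
  have hι2 : ι * ι ∈ S ⊔ E := Subgroup.mem_sup_right (hE.barKer_le h2)
  have hconj : ∀ p ∈ S ⊔ E, ι * p * ι⁻¹ ∈ S ⊔ E :=
    fun p hp => X.inversion_conj_mem_sup hH' hH hι hE hS h2 hp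
  constructor
  · intro hx
    -- the set of elements of the two stated shapes is a subgroup containing `S ⊔ E` and `ι`
    let M : Subgroup X.PiC :=
      { carrier := {x | x ∈ S ⊔ E ∨ ∃ p ∈ S ⊔ E, x = p * ι}
        mul_mem' := by
          rintro a b (ha | ⟨p, hp, rfl⟩) (hb | ⟨q, hq, rfl⟩)
          · exact Or.inl (Subgroup.mul_mem _ ha hb)
          · exact Or.inr ⟨a * q, Subgroup.mul_mem _ ha hq, by group⟩
          · refine Or.inr ⟨p * (ι * b * ι⁻¹), Subgroup.mul_mem _ hp (hconj b hb), by group⟩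
          · refine Or.inl ?_
            have : p * ι * (q * ι) = p * (ι * q * ι⁻¹) * (ι * ι) := by group
            rw [this]
            exact Subgroup.mul_mem _ (Subgroup.mul_mem _ hp (hconj q hq)) hι2
        one_mem' := Or.inl (Subgroup.one_mem _)
        inv_mem' := by
          rintro a (ha | ⟨p, hp, rfl⟩)
          · exact Or.inl (Subgroup.inv_mem _ ha)
          · refine Or.inr ⟨(ι * ι)⁻¹ * (ι * p⁻¹ * ι⁻¹), Subgroup.mul_mem _ (Subgroup.inv_mem _ hι2)
              (hconj p⁻¹ (Subgroup.inv_mem _ hp)), by group⟩ }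
    have hle : (S ⊔ E) ⊔ Subgroup.zpowers ι ≤ M := by
      refine sup_le (fun p hp => Or.inl hp) ?_
      rw [Subgroup.zpowers_le]
      exact Or.inr ⟨1, Subgroup.one_mem _, by group⟩
    exact hle hx
  · rintro (hx | ⟨p, hp, rfl⟩)
    · exact Subgroup.mem_sup_left hx
    · exact Subgroup.mul_mem _ (Subgroup.mem_sup_left hp)
        (Subgroup.mem_sup_right (Subgroup.mem_zpowers ι))

/-- **Prop 2.2 (iii), second sentence — the cartesian square**: `⟨Π_X̲̲, ι̲⟩ ∩ Π_X̲ = Π_X̲̲` for an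
inversion `ι̲` of order `2` in `Δ̄_C̲`. [cite: MochizukiEtTh2009, Prop 2.2(iii) p.37] -/
theorem sup_zpowers_inf_eq {H H' E S : Subgroup X.PiC} {ι : X.PiC}
    (hH' : X.toCoverData.IsTypeLTorsPm H') (hH : H = H' ⊓ X.PiX)
    (hι : X.toCoverData.IsInversion H' ι) (hE : X.toCoverData.IsMinusEigen H H' ι E)
    (hS : X.toCoverData.IsSplitting S) (h2 : ι * ι ∈ X.barKer) :
    ((S ⊔ E) ⊔ Subgroup.zpowers ι) ⊓ H = S ⊔ E := by
  have hT : X.toCoverData.IsTypeLTors H := by rw [hH]; exact hH'.inf_isTypeLTors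
  have hHX : H ≤ X.PiX := hT.le
  have hSle : S ≤ H :=
    hS.le.trans (sup_le hT.Dx_le (X.barKer_le_barTheta.trans hT.barTheta_le))
  have hEle : E ≤ H := hE.le.trans inf_le_left
  refine le_antisymm ?_ (le_inf le_sup_left (sup_le hSle hEle))
  rintro x ⟨hx, hxH⟩
  rcases (X.mem_sup_zpowers_iff hH' hH hι hE hS h2).mp hx with hx' | ⟨p, hp, rfl⟩
  · exact hx'
  · exact absurd ((Subgroup.mul_mem_cancel_left X.PiX (hHX (sup_le hSle hEle hp))).mp (hHX hxH))
      hι.not_mem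

/-- **Prop 2.2 (iii), second sentence — the double covering `X̲̲ → C̲̲`**: `[⟨Π_X̲̲, ι̲⟩ : Π_X̲̲] = 2`.
[cite: MochizukiEtTh2009, Prop 2.2(iii) p.37] -/
theorem relIndex_sup_zpowers {H H' E S : Subgroup X.PiC} {ι : X.PiC}
    (hH' : X.toCoverData.IsTypeLTorsPm H') (hH : H = H' ⊓ X.PiX)
    (hι : X.toCoverData.IsInversion H' ι) (hE : X.toCoverData.IsMinusEigen H H' ι E)
    (hS : X.toCoverData.IsSplitting S) (h2 : ι * ι ∈ X.barKer) :
    (S ⊔ E).relIndex ((S ⊔ E) ⊔ Subgroup.zpowers ι) = 2 := by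
  have hT : X.toCoverData.IsTypeLTors H := by rw [hH]; exact hH'.inf_isTypeLTors
  have hHX : H ≤ X.PiX := hT.le
  have hSle : S ≤ H :=
    hS.le.trans (sup_le hT.Dx_le (X.barKer_le_barTheta.trans hT.barTheta_le))
  have hEle : E ≤ H := hE.le.trans inf_le_left
  have hPX : S ⊔ E ≤ X.PiX := (sup_le hSle hEle).trans hHX
  have hι2 : ι * ι ∈ S ⊔ E := Subgroup.mem_sup_right (hE.barKer_le h2)
  have hιP : ι ∉ S ⊔ E := fun h => hι.not_mem (hPX h)
  rw [Subgroup.relIndex_eq_two_iff]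
  refine ⟨ι, Subgroup.mem_sup_right (Subgroup.mem_zpowers ι), fun b hb => ?_⟩
  rcases (X.mem_sup_zpowers_iff hH' hH hι hE hS h2).mp hb with hb' | ⟨p, hp, rfl⟩
  · refine Or.inr ⟨hb', fun h => hιP ?_⟩
    exact (Subgroup.mul_mem_cancel_left (S ⊔ E) hb').mp h
  · refine Or.inl ⟨?_, fun h => hιP ((Subgroup.mul_mem_cancel_left (S ⊔ E) hp).mp h)⟩
    have : p * ι * ι = p * (ι * ι) := by group
    rw [this]
    exact Subgroup.mul_mem _ hp hι2

/-- **Proposition 2.2 (ii) DISCHARGED** over `CoverDataAx` (the named fact of `ThetaCovers.lean` v2: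
`D_x · E = Π_X̲`, `D_x ∩ E ⊆ Ker`, `(S · E) ∩ Δ_C = E`). [cite: MochizukiEtTh2009, Prop 2.2(ii) p.37] -/
theorem prop22_ii_holds : X.toCoverData.Prop22_ii := by
  intro H H' E S ι hH' hH _hι hE hS
  exact ⟨X.Dx_sup_eigen_eq hH' hH hE, X.Dx_inf_eigen_le hE,
    X.splitting_sup_eigen_inf_deltaC hH' hH hE hS⟩

/-- **Proposition 2.2 (iii) DISCHARGED** over `CoverDataAx` (the named fact of `ThetaCovers.lean` v2,
order `2` read in `Δ̄_C̲`). [cite: MochizukiEtTh2009, Prop 2.2(iii) p.37] -/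
theorem prop22_iii_holds : X.toCoverData.Prop22_iii := by
  intro H H' E S ι hH' hH hι hE hS
  exact ⟨X.exists_inversion_sq_mem_barKer hH' hH hι hE,
    fun h2 => ⟨X.sup_zpowers_inf_eq hH' hH hι hE hS h2, X.relIndex_sup_zpowers hH' hH hι hE hS h2⟩⟩

end CoverDataAx

end ThetaCovers

end Literature.AnabelianGeometry.EtaleTheta
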